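import Literature.AlgebraicGeometry.Motives.HodgeDecompositionHarmonicRepresentativeProofs
import Literature.AlgebraicGeometry.Motives.HodgeDecompositionIsInternalDischarge
import HarnessLib

/-!
# `H^{p,q} = K^{p,q} ≅ ℋ^{p,q}` holds: unique `∂̄`-harmonic representatives (discharge of `existsUnique_isDolbeaultHarmonic_of_mem_hodgePQ`)

Trunk **T-KAEHLER** (`AlgebraicGeometry/Motives`). Theorems-only leaf companion of
`HodgeDecomposition.lean` (the named fact
`Literature.AlgebraicGeometry.Motives.existsUnique_isDolbeaultHarmonic_of_mem_hodgePQ g o`, **hodge.S07**,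
harmonic-representative form: on a compact Kähler manifold `(M, g)` every class
`c ∈ K^{p,q} = hodgePQ E M (p+q) p q` has a unique representative which is closed and `∂̄`-harmonic of
type `(p,q)`; C. Voisin, *Hodge Theory and Complex Algebraic Geometry I* (2002), §6.1.3 Prop. 6.11 with
Cor. 6.10 and Thm. 5.23, PDF pp. 120–121; D. Huybrechts, *Complex Geometry* (2005), Cor. 3.2.12) and of
its reduction file `HodgeDecompositionHarmonicRepresentativeProofs.lean`, whose
`exists_mem_dolbeaultHarmonicForms_mk_eq_of` / `eq_of_mem_dolbeaultHarmonicForms_of_mk_eq` reduce the fact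
to Warner's Theorem 6.11 for the metric `g` (`h11`) and the Kähler identity `Δ_d = 2Δ_∂̄` (`hK`).

Both inputs are now THEOREMS of the tree at a Kähler metric: `Δ_d = 2Δ_∂̄` is
`cHodgeLaplacian_eq_two_smul_dolbeaultLaplacian_of_isManifold_complex_of_t2Space` (Voisin Thm. 6.7),
and Warner's Theorem 6.11 at a KÄHLER metric is `existsUnique_isHarmonicForm_mk_eq_of_compact_of_dolbeault`
(`HodgeDecompositionIsInternalDolbeaultProofs.lean`, Voisin Thm. 5.23 by her route 5.22 ⇒ 5.24 ⇒ 6.7)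
fed with Warner's Theorems 6.6 / 6.5 for `Δ_∂̄` on `A^{p,q}(M)` — `CL2SmoothForms.pq_compact`
(`TorusDolbeaultCompactAll`) and `CL2SmoothForms.pq_regular` (`TorusDolbeaultRegularityPq`), exactly as in
`HodgeDecompositionIsInternalDischarge.lean`. Since the fact binds the Kähler hypothesis `hg` before
the degree, the reduction lemma `existsUnique_isDolbeaultHarmonic_of_mem_hodgePQ_of` (which asks for
`h11` at every metric) is bypassed and its five-line proof repeated with `h11` produced from `hg`.

* **`existsUnique_isDolbeaultHarmonic_of_mem_hodgePQ_holds g o`** — discharge of the named fact, for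
  every smooth metric term `g` and orientation family `o` (the fact's own parameters; its content is
  conditional on `g` being Kähler, a binder inside the fact).

No definition and no named fact is introduced (D-0026).

## References

* C. Voisin, *Hodge Theory and Complex Algebraic Geometry I* (2002), §5.3.1 Thm. 5.23, §6.1.2
  Thm. 6.7, Cor. 6.10, §6.1.3 Prop. 6.11 (PDF pp. 120–121). [Voisin2002] [VoisinHodgeI2002]
* D. Huybrechts, *Complex Geometry* (2005), Thm. 3.2.8, Cor. 3.2.12 (PDF pp. 152–154). [Huybrechts2005]
* F. W. Warner, *Foundations of Differentiable Manifolds and Lie Groups*, GTM 94 (1983), Thms. 6.5,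
  6.6, 6.11. [WarnerGTM94]
-/

noncomputable section

open scoped Manifold ContDiff Topology ComplexInnerProductSpace
open Bundle Module

namespace Literature.AlgebraicGeometry.Motives

open Literature.Geometry.Kaehler Literature.NumberTheory.Transcendental

variable {E : Type*} [NormedAddCommGroup E] [NormedSpace ℂ E]
  {M : Type*} [TopologicalSpace M] [ChartedSpace E M]
  [FiniteDimensional ℂ E] [IsManifold 𝓘(ℝ, E) ∞ M] {n : ℕ} [Fact (finrank ℝ E = n)]
  (g : ContMDiffRiemannianMetric 𝓘(ℝ, E) ∞ E (fun x : M ↦ TangentSpace 𝓘(ℝ, E) x))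
  (o : (x : M) → Orientation ℝ (TangentSpace 𝓘(ℝ, E) x) (Fin n))

/-- **Warner's Theorem 6.11 at a Kähler metric, in one degree** (Voisin (2002), Thm. 5.23 for the
Kähler metric of `g`): the hodge.S08 `Prop` `existsUnique_isHarmonicForm_mk_eq (k) (m) 𝓘(ℝ, E) o` for
the Riemannian bundle of `g`, from `existsUnique_isHarmonicForm_mk_eq_of_compact_of_dolbeault` fed with
the tree's theorems `CL2SmoothForms.pq_compact` / `pq_regular` (Warner 6.6 / 6.5 for `Δ_∂̄` on
`A^{p,q}(M)`). [cite: Voisin2002, Thm. 5.23] -/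
theorem existsUnique_isHarmonicForm_mk_eq_of_isKaehler [IsManifold 𝓘(ℂ, E) ω M] [CompactSpace M]
    [T2Space M] (hg : g.toRiemannianMetric.IsKaehler) (k m : ℕ) :
    letI : RiemannianBundle (fun x : M ↦ TangentSpace 𝓘(ℝ, E) x) := ⟨g.toRiemannianMetric⟩
    haveI : IsContMDiffRiemannianBundle 𝓘(ℝ, E) ∞ E (fun x : M ↦ TangentSpace 𝓘(ℝ, E) x) :=
      ⟨g.inner, g.contMDiff, fun _ _ _ ↦ rfl⟩
    existsUnique_isHarmonicForm_mk_eq (k := k) (m := m) 𝓘(ℝ, E) o := by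
  letI : RiemannianBundle (fun x : M ↦ TangentSpace 𝓘(ℝ, E) x) := ⟨g.toRiemannianMetric⟩
  haveI : IsContMDiffRiemannianBundle 𝓘(ℝ, E) ∞ E (fun x : M ↦ TangentSpace 𝓘(ℝ, E) x) :=
    ⟨g.inner, g.contMDiff, fun _ _ _ ↦ rfl⟩
  refine (existsUnique_isHarmonicForm_mk_eq_of_compact_iff 𝓘(ℝ, E) M o k m).1
    (existsUnique_isHarmonicForm_mk_eq_of_compact_of_dolbeault g o hg ?_ ?_ k m)
  · intro _ _ hJ p q m' h ho
    letI : RiemannianBundle (fun x : M ↦ TangentSpace 𝓘(ℝ, E) x) := ⟨g.toRiemannianMetric⟩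
    haveI : IsContMDiffRiemannianBundle 𝓘(ℝ, E) ∞ E (fun x : M ↦ TangentSpace 𝓘(ℝ, E) x) :=
      ⟨g.inner, g.contMDiff, fun _ _ _ ↦ rfl⟩
    haveI : Fact (IsSmoothForm (riemannianVolumeForm o)) := ⟨ho⟩
    exact fun u c hb hΔ ↦ CL2SmoothForms.pq_compact o hJ p q h u c hb hΔ
  · intro _ _ hJ p q m' h ho
    letI : RiemannianBundle (fun x : M ↦ TangentSpace 𝓘(ℝ, E) x) := ⟨g.toRiemannianMetric⟩
    haveI : IsContMDiffRiemannianBundle 𝓘(ℝ, E) ∞ E (fun x : M ↦ TangentSpace 𝓘(ℝ, E) x) :=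
      ⟨g.inner, g.contMDiff, fun _ _ _ ↦ rfl⟩
    haveI : Fact (IsSmoothForm (riemannianVolumeForm o)) := ⟨ho⟩
    exact fun α ℓ hw ↦ CL2SmoothForms.pq_regular o hJ p q h α ℓ hw

/-- **hodge.S07, harmonic-representative form — discharge of the named fact
`existsUnique_isDolbeaultHarmonic_of_mem_hodgePQ g o`** (Voisin (2002), §6.1.3 Prop. 6.11:
`H^{p,q} = K^{p,q}`, with Cor. 6.10 and Thm. 5.23; Huybrechts (2005), Thm. 3.2.8 / Cor. 3.2.12): on a
compact Kähler manifold `(M, g)` (holomorphic atlas, `g` Kähler, `vol_o` smooth, `(p + q) + m = n`) every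
class `c ∈ K^{p,q} = hodgePQ E M (p+q) p q` has exactly one representative `α ∈ ℋ^{p,q}_g` which is a
closed smooth form with `[α] = c`. Existence: `exists_mem_dolbeaultHarmonicForms_mk_eq_of` fed Warner's
Theorem 6.11 at the Kähler metric (`existsUnique_isHarmonicForm_mk_eq_of_isKaehler`) and the Kähler
identity `Δ_d = 2Δ_∂̄` (`cHodgeLaplacian_eq_two_smul_dolbeaultLaplacian_of_isManifold_complex_of_t2Space`);
uniqueness: `eq_of_mem_dolbeaultHarmonicForms_of_mk_eq`.
[cite: Voisin2002, §6.1.3 Prop. 6.11] [cite: Huybrechts2005, Cor. 3.2.12] -/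
theorem existsUnique_isDolbeaultHarmonic_of_mem_hodgePQ_holds :
    existsUnique_isDolbeaultHarmonic_of_mem_hodgePQ g o := by
  intro _ _ _ hg p q m h c hc ho
  have hK : ∀ {k m : ℕ},
      cHodgeLaplacian_eq_two_smul_dolbeaultLaplacian_of_isManifold_complex (k := k) (m := m) g o :=
    fun {k m} ↦ cHodgeLaplacian_eq_two_smul_dolbeaultLaplacian_of_isManifold_complex_of_t2Space g o
  have h11 := existsUnique_isHarmonicForm_mk_eq_of_isKaehler g o hg (p + q) m
  obtain ⟨α, hα, hαc, hmk⟩ := exists_mem_dolbeaultHarmonicForms_mk_eq_of g o h11 hK hg h hc ho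
  refine ⟨α, ⟨hα, hαc, hmk⟩, ?_⟩
  rintro β ⟨hβ, hβc, hmk'⟩
  exact eq_of_mem_dolbeaultHarmonicForms_of_mk_eq g o hK hg h hβc hαc (hmk'.trans hmk.symm) ho hβ hα

end Literature.AlgebraicGeometry.Motives

end
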